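import Literature.Analysis.FluidPDE.TaoCascadeFiveModes
import HarnessLib

/-!
# Tao's cascade ODE, §6.6: the scale-one secondary equations with explicit errors (for Prop. 6.13)

T. Tao, *Finite time blowup for an averaged three-dimensional Navier–Stokes equation*,
J. Amer. Math. Soc. **29** (2016), 601–674 = arXiv:1402.0290v3, §6.6, proof of Prop. 6.13 ("Small
`a₁` implies small `b₁, c₁, d₁`"), which runs on the equations (6.46)–(6.48) at scale `k = 1`:
"From (6.47) one has `|∂ₜc₁| ≤ O(ε²exp(-K^{10})Ẽ₁) + (1+ε₀)^{5/2}ε⁻¹K^{10}|b₁||c₁| + O((1+ε₀)^{-n₀/2}Ẽ₁^{1/2})`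
… from (6.46) one has `|∂ₜb₁| ≤ εa₁² + ε⁻¹K^{10}c₁² + O((1+ε₀)^{-n₀}Ẽ₁^{1/2})` … from (6.48) …
`∂ₜd₁ = O(exp(-K^{10}/2)) + O(K^{-14}|d₁|)`".

Here the three equations are put, **pointwise in time**, in the forms used there, from
`RescaledHypotheses γ …` (`TaoCascadeRescaled.lean`) with explicit errors: the error weight at
scale `1` is `C₁(1+ε₀)^{2-n₀/2}√Ẽ₁` and the prefactor is `(1+ε₀)^{5/2}` (the source's displays drop
it into the `O()`/`≲`). Companion of `TaoCascadeFiveModes.lean` (scale `0`, and `∂ₜa₁`) and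
`TaoCascadeCoarseModes.lean` (scale `-1`).

## References

* T. Tao, J. Amer. Math. Soc. 29 (2016), 601–674, arXiv:1402.0290v3, §6.4 (6.46)–(6.49), §6.6
  proof of Prop. 6.13. [`Tao2016AveragedNS`]
-/

noncomputable section

open Set MeasureTheory

namespace Literature.Analysis.FluidPDE

namespace TaoCascade

section FineModes

variable {γ ε₀ K ε C₁ C₂ C₃ : ℝ} {n₀ N : ℤ} {τ : ℤ → ℝ} {Xr : Fin 4 → ℤ → ℝ → ℝ} {Er : ℤ → ℝ → ℝ}

/-- **(6.46) at scale `1`**: `|∂ₜb₁ - (1+ε₀)^{5/2}(εa₁² - ε⁻¹K^{10}c₁²)| ≤ C₁(1+ε₀)^{2-n₀/2}√Ẽ₁`.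
[cite: Tao2016AveragedNS, §6.4 (6.46)] -/
theorem RescaledHypotheses.eq_b_one
    (h : RescaledHypotheses γ ε₀ K ε C₁ C₂ C₃ n₀ N τ Xr Er) {t : ℝ} (ht : τ (n₀ - N) ≤ t) :
    |derivWithin (Xr 1 1) (Ici (τ (n₀ - N))) t -
        (1 + ε₀) ^ ((5 : ℝ) / 2) * (ε * Xr 0 1 t ^ 2 - ε⁻¹ * K ^ 10 * Xr 2 1 t ^ 2)| ≤
      C₁ * (1 + ε₀) ^ (2 - (n₀ : ℝ) / 2) * Real.sqrt (Er 1 t) := by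
  have h2 := h.eq2 1 t ht
  simpa only [Int.cast_one, mul_one] using h2

/-- **(6.47) at scale `1`**: `|∂ₜc₁ - (1+ε₀)^{5/2}(ε²e^{-K^{10}}a₁² + ε⁻¹K^{10}b₁c₁)| ≤
C₁(1+ε₀)^{2-n₀/2}√Ẽ₁`. [cite: Tao2016AveragedNS, §6.4 (6.47)] -/
theorem RescaledHypotheses.eq_c_one
    (h : RescaledHypotheses γ ε₀ K ε C₁ C₂ C₃ n₀ N τ Xr Er) {t : ℝ} (ht : τ (n₀ - N) ≤ t) :
    |derivWithin (Xr 2 1) (Ici (τ (n₀ - N))) t -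
        (1 + ε₀) ^ ((5 : ℝ) / 2) *
          (ε ^ 2 * Real.exp (-K ^ 10) * Xr 0 1 t ^ 2 + ε⁻¹ * K ^ 10 * Xr 1 1 t * Xr 2 1 t)| ≤
      C₁ * (1 + ε₀) ^ (2 - (n₀ : ℝ) / 2) * Real.sqrt (Er 1 t) := by
  have h3 := h.eq3 1 t ht
  simpa only [Int.cast_one, mul_one] using h3

/-- **(6.48) at scale `1`**: `|∂ₜd₁ - (1+ε₀)^{5/2}(ε⁻²c₁a₁ - (1+ε₀)^{5/2}Kd₁a₂)| ≤ C₁(1+ε₀)^{2-n₀/2}√Ẽ₁`.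
[cite: Tao2016AveragedNS, §6.4 (6.48)] -/
theorem RescaledHypotheses.eq_d_one
    (h : RescaledHypotheses γ ε₀ K ε C₁ C₂ C₃ n₀ N τ Xr Er) {t : ℝ} (ht : τ (n₀ - N) ≤ t) :
    |derivWithin (Xr 3 1) (Ici (τ (n₀ - N))) t -
        (1 + ε₀) ^ ((5 : ℝ) / 2) *
          ((ε ^ 2)⁻¹ * Xr 2 1 t * Xr 0 1 t - (1 + ε₀) ^ ((5 : ℝ) / 2) * K * Xr 3 1 t * Xr 0 2 t)| ≤
      C₁ * (1 + ε₀) ^ (2 - (n₀ : ℝ) / 2) * Real.sqrt (Er 1 t) := by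
  have h4 := h.eq4 1 t ht
  simpa only [Int.cast_one, mul_one, Int.reduceAdd] using h4

/-- **The `c₁`-equation in linear form** (proof of Prop. 6.13): `|∂ₜc₁ - ((1+ε₀)^{5/2}ε⁻¹K^{10}b₁)·c₁| ≤
(1+ε₀)^{5/2}ε²e^{-K^{10}}a₁² + C₁(1+ε₀)^{2-n₀/2}√Ẽ₁` — the shape of
`abs_le_linearComparison` with rate `β = (1+ε₀)^{5/2}ε⁻¹K^{10}b₁`.
[cite: Tao2016AveragedNS, §6.6 proof of Prop. 6.13] -/
theorem RescaledHypotheses.c_one_linear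
    (h : RescaledHypotheses γ ε₀ K ε C₁ C₂ C₃ n₀ N τ Xr Er) (hε₀ : -1 < ε₀) {t : ℝ}
    (ht : τ (n₀ - N) ≤ t) :
    |derivWithin (Xr 2 1) (Ici (τ (n₀ - N))) t -
        ((1 + ε₀) ^ ((5 : ℝ) / 2) * (ε⁻¹ * K ^ 10) * Xr 1 1 t) * Xr 2 1 t| ≤
      (1 + ε₀) ^ ((5 : ℝ) / 2) * (ε ^ 2 * Real.exp (-K ^ 10)) * Xr 0 1 t ^ 2 +
        C₁ * (1 + ε₀) ^ (2 - (n₀ : ℝ) / 2) * Real.sqrt (Er 1 t) := by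
  have he := h.eq_c_one ht
  have hQ : 0 < (1 + ε₀) ^ ((5 : ℝ) / 2) := Real.rpow_pos_of_pos (by linarith) _
  have key : derivWithin (Xr 2 1) (Ici (τ (n₀ - N))) t -
      ((1 + ε₀) ^ ((5 : ℝ) / 2) * (ε⁻¹ * K ^ 10) * Xr 1 1 t) * Xr 2 1 t =
      (derivWithin (Xr 2 1) (Ici (τ (n₀ - N))) t -
        (1 + ε₀) ^ ((5 : ℝ) / 2) *
          (ε ^ 2 * Real.exp (-K ^ 10) * Xr 0 1 t ^ 2 + ε⁻¹ * K ^ 10 * Xr 1 1 t * Xr 2 1 t)) +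
        (1 + ε₀) ^ ((5 : ℝ) / 2) * (ε ^ 2 * Real.exp (-K ^ 10)) * Xr 0 1 t ^ 2 := by ring
  rw [key]
  refine (abs_add_le _ _).trans ?_
  rw [abs_of_nonneg (by positivity :
    (0 : ℝ) ≤ (1 + ε₀) ^ ((5 : ℝ) / 2) * (ε ^ 2 * Real.exp (-K ^ 10)) * Xr 0 1 t ^ 2)]
  linarith

/-- **The `b₁`-equation, bound on `|∂ₜb₁|`** (proof of Prop. 6.13): `|∂ₜb₁| ≤
(1+ε₀)^{5/2}(ε a₁² + ε⁻¹K^{10} c₁²) + C₁(1+ε₀)^{2-n₀/2}√Ẽ₁` (`ε > 0`).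
[cite: Tao2016AveragedNS, §6.6 proof of Prop. 6.13] -/
theorem RescaledHypotheses.b_one_deriv_abs_le
    (h : RescaledHypotheses γ ε₀ K ε C₁ C₂ C₃ n₀ N τ Xr Er) (hε : 0 < ε) (hε₀ : -1 < ε₀) {t : ℝ}
    (ht : τ (n₀ - N) ≤ t) :
    |derivWithin (Xr 1 1) (Ici (τ (n₀ - N))) t| ≤
      (1 + ε₀) ^ ((5 : ℝ) / 2) * (ε * Xr 0 1 t ^ 2 + ε⁻¹ * K ^ 10 * Xr 2 1 t ^ 2) +
        C₁ * (1 + ε₀) ^ (2 - (n₀ : ℝ) / 2) * Real.sqrt (Er 1 t) := by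
  have he := h.eq_b_one ht
  have hQ : 0 < (1 + ε₀) ^ ((5 : ℝ) / 2) := Real.rpow_pos_of_pos (by linarith) _
  have hmain : |(1 + ε₀) ^ ((5 : ℝ) / 2) * (ε * Xr 0 1 t ^ 2 - ε⁻¹ * K ^ 10 * Xr 2 1 t ^ 2)| ≤
      (1 + ε₀) ^ ((5 : ℝ) / 2) * (ε * Xr 0 1 t ^ 2 + ε⁻¹ * K ^ 10 * Xr 2 1 t ^ 2) := by
    rw [abs_mul, abs_of_pos hQ]
    apply mul_le_mul_of_nonneg_left _ hQ.le
    refine (abs_sub _ _).trans ?_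
    rw [abs_of_nonneg (by positivity), abs_of_nonneg (by positivity)]
  have := abs_sub_abs_le_abs_sub (derivWithin (Xr 1 1) (Ici (τ (n₀ - N))) t)
    ((1 + ε₀) ^ ((5 : ℝ) / 2) * (ε * Xr 0 1 t ^ 2 - ε⁻¹ * K ^ 10 * Xr 2 1 t ^ 2))
  linarith

/-- **The `d₁`-equation in linear form** (proof of Prop. 6.13, last paragraph:
"`∂ₜd₁ = O(exp(-K^{10}/2)) + O(K^{-14}|d₁|)`"): with `|c₁| ≤ B_c`, `Ẽ₁ ≤ 1`, `Ẽ₂ ≤ E₂`,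
`|∂ₜd₁ - (-(1+ε₀)^{5}K a₂)·d₁| ≤ (1+ε₀)^{5/2}ε⁻²B_c√2 + C₁(1+ε₀)^{2-n₀/2}`, and the rate obeys
`|(1+ε₀)^5 K a₂| ≤ (1+ε₀)^5 K √(2E₂)`. [cite: Tao2016AveragedNS, §6.6 proof of Prop. 6.13] -/
theorem RescaledHypotheses.d_one_linear
    (h : RescaledHypotheses γ ε₀ K ε C₁ C₂ C₃ n₀ N τ Xr Er) (hε₀ : -1 < ε₀) (hC₁ : 0 ≤ C₁)
    {t Bc : ℝ} (ht : τ (n₀ - N) ≤ t) (hE1 : Er 1 t ≤ 1) (hc : |Xr 2 1 t| ≤ Bc) :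
    |derivWithin (Xr 3 1) (Ici (τ (n₀ - N))) t -
        (-((1 + ε₀) ^ ((5 : ℝ) / 2) * (1 + ε₀) ^ ((5 : ℝ) / 2) * K * Xr 0 2 t)) * Xr 3 1 t| ≤
      (1 + ε₀) ^ ((5 : ℝ) / 2) * (ε ^ 2)⁻¹ * Bc * Real.sqrt 2 +
        C₁ * (1 + ε₀) ^ (2 - (n₀ : ℝ) / 2) := by
  have he := h.eq_d_one ht
  have hq0 : (0 : ℝ) < 1 + ε₀ := by linarith
  have hQ : 0 < (1 + ε₀) ^ ((5 : ℝ) / 2) := Real.rpow_pos_of_pos hq0 _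
  have hBc : 0 ≤ Bc := (abs_nonneg _).trans hc
  have ha : |Xr 0 1 t| ≤ Real.sqrt 2 :=
    (h.abs_le_sqrt_energy 0 1 ht).trans (Real.sqrt_le_sqrt (by linarith))
  have hsq : Real.sqrt (Er 1 t) ≤ 1 := by
    rw [Real.sqrt_le_left zero_le_one]; simpa using hE1
  have hw : 0 ≤ C₁ * (1 + ε₀) ^ (2 - (n₀ : ℝ) / 2) := mul_nonneg hC₁ (Real.rpow_nonneg hq0.le _)
  have key : derivWithin (Xr 3 1) (Ici (τ (n₀ - N))) t -
      (-((1 + ε₀) ^ ((5 : ℝ) / 2) * (1 + ε₀) ^ ((5 : ℝ) / 2) * K * Xr 0 2 t)) * Xr 3 1 t =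
      (derivWithin (Xr 3 1) (Ici (τ (n₀ - N))) t -
        (1 + ε₀) ^ ((5 : ℝ) / 2) *
          ((ε ^ 2)⁻¹ * Xr 2 1 t * Xr 0 1 t - (1 + ε₀) ^ ((5 : ℝ) / 2) * K * Xr 3 1 t * Xr 0 2 t)) +
        (1 + ε₀) ^ ((5 : ℝ) / 2) * (ε ^ 2)⁻¹ * (Xr 2 1 t * Xr 0 1 t) := by ring
  rw [key]
  refine (abs_add_le _ _).trans (add_le_add (he.trans ?_) ?_) |>.trans_eq (add_comm _ _)
  · calc C₁ * (1 + ε₀) ^ (2 - (n₀ : ℝ) / 2) * Real.sqrt (Er 1 t)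
        ≤ C₁ * (1 + ε₀) ^ (2 - (n₀ : ℝ) / 2) * 1 := mul_le_mul_of_nonneg_left hsq hw
      _ = _ := mul_one _
  · rw [abs_mul, abs_of_nonneg (by positivity : (0 : ℝ) ≤ (1 + ε₀) ^ ((5 : ℝ) / 2) * (ε ^ 2)⁻¹),
      abs_mul]
    have : |Xr 2 1 t| * |Xr 0 1 t| ≤ Bc * Real.sqrt 2 := mul_le_mul hc ha (abs_nonneg _) hBc
    calc (1 + ε₀) ^ ((5 : ℝ) / 2) * (ε ^ 2)⁻¹ * (|Xr 2 1 t| * |Xr 0 1 t|)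
        ≤ (1 + ε₀) ^ ((5 : ℝ) / 2) * (ε ^ 2)⁻¹ * (Bc * Real.sqrt 2) :=
          mul_le_mul_of_nonneg_left this (by positivity)
      _ = _ := by ring

/-- The rate of `d_one_linear` is small: `|(1+ε₀)^5 K a₂| ≤ (1+ε₀)^5 K √(2Ẽ₂)` (`K ≥ 0`).
[cite: Tao2016AveragedNS, §6.6 proof of Prop. 6.13] -/
theorem RescaledHypotheses.d_one_rate_abs_le
    (h : RescaledHypotheses γ ε₀ K ε C₁ C₂ C₃ n₀ N τ Xr Er) (hε₀ : -1 < ε₀) (hK : 0 ≤ K) {t : ℝ}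
    (ht : τ (n₀ - N) ≤ t) :
    |-((1 + ε₀) ^ ((5 : ℝ) / 2) * (1 + ε₀) ^ ((5 : ℝ) / 2) * K * Xr 0 2 t)| ≤
      (1 + ε₀) ^ ((5 : ℝ) / 2) * (1 + ε₀) ^ ((5 : ℝ) / 2) * K * Real.sqrt (2 * Er 2 t) := by
  have hQ : 0 < (1 + ε₀) ^ ((5 : ℝ) / 2) := Real.rpow_pos_of_pos (by linarith) _
  rw [abs_neg, abs_mul, abs_of_nonneg (by positivity)]
  exact mul_le_mul_of_nonneg_left (h.abs_le_sqrt_energy 0 2 ht) (by positivity)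

end FineModes

end TaoCascade

end Literature.Analysis.FluidPDE
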